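import Summits.QuantumFields.YangMills.Theorems.SwapVirialDeficitZeroModeThreeNoLog
import HarnessLib

/-!
# The `k = 3` zero-mode block is REGULAR, IV-a: the symmetrised LOWER representation (toward the power remainder `β^{-1/4}`)
# (free-hands support of crux ⟨stmt-QuantumFields-24197⟩ `SwapVirialDeficit.SwapGluedStiffness`, LINE «sharp-sigma»; companion of files I–III
# ✓`SwapVirialDeficitZeroModeThree{Scaling,Bound,NoLog}`)

In the symmetrised picture of file II (largest column `a = r e₃`, the other two rescaled by `Λ_r = diag(1/(r√β), 1/(r√β), r)`, determinant `(rβ)⁻²`)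
the conditional integrals are EXACTLY integrals of `β`-dependent kernels on `(ℝ³)²` squeezed between two `β`-free ones:

* §11 LOWER symmetrisation with strict boxes: `3∫Φ⁻₃(β,a) da ≤ ∫F₃` (`Φ⁻₃` = strict box `‖x_μ‖ < ‖a‖`; at most one column is strictly largest), rotation;
* §12 the EXACT rescaled lower kernel `k_β(r,y) = 𝟙{plSq(y_μ)/(r⁴β) + y_μ2² < 1 ∀μ}·exp(−(y₀₀y₁₁−y₀₁y₁₀)²/(r⁴β) − cr − plSum − plSum/(2r²β) − r²(y₀₂²+y₁₂²)/2)`: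
  `G⁻₃(β, re₃)(Λ_r y) = e^{−r²/2}·k_β(r,y)`, hence ★ `(rβ)²·Φ⁻₃(β,re₃) = e^{−r²/2}∫k_β(r,·)` and ★★ `3∫ e^{−‖a‖²/2}‖a‖⁻² ∫k_β(‖a‖,·) ≤ β²Z₃(β)`;
(file IV-b ✓`SwapVirialDeficitZeroModeThreeUpper` adds the `β`-free upper kernel `k_∞`, `A₃ ≤ L₃` and the pointwise gap `k_∞ ≤ k_β + d_β`; files V–VI integrate
`d_β` and split radially at `ρ = β^{-1/4}` to get `|β²Z₃(β) − A₃| ≤ K·β^{-1/4}`, the `t^{1/4}` correction of the LINE card «sharp-sigma»).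

HONEST LABEL: finite-dimensional Laplace analysis (plan-level zero-mode rung of a DRAFT line); not the fixed-`L` sharp law, not ⟨24197⟩/⟨24194⟩, no rung /
summit statement; the Yang–Mills mass gap is NOT proved; no summit is proved by a line.  Width seat ym-line-sfw-p2-w3 g62 (cell ym-idea-1, free hands),
`--supports stmt-QuantumFields-24197`.  Standard axioms, 0 `sorry`.  References: [cite: tHooft1979]; [cite: Vanbaal2001]; [folklore].
-/

set_option autoImplicit false

noncomputable section

namespace Summit.QuantumFields.YangMills.Theorems.ToronValleyVolume.ZeroMode

open MeasureTheory Real Finset Set Filter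
open scoped ENNReal Topology
open Summit.QuantumFields.YangMills.Cruxes.ToronTubeVolumeLaw.Birth

/-! ## §11 Lower symmetrisation with strict boxes -/

/-- Column `ν` is strictly the largest of the three. -/
def Amax3 (ν : Fin 3) : Set (Fin 3 → EuclideanSpace ℝ (Fin 3)) := {c | ∀ μ, μ ≠ ν → ‖c μ‖ < ‖c ν‖}

/-- `Amax3 ν` is measurable (open). [folklore] -/
theorem measurableSet_Amax3 (ν : Fin 3) : MeasurableSet (Amax3 ν) := by
  have : Amax3 ν = ⋂ μ, {c : Fin 3 → EuclideanSpace ℝ (Fin 3) | μ ≠ ν → ‖c μ‖ < ‖c ν‖} := by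
    ext c; simp [Amax3]
  rw [this]
  refine MeasurableSet.iInter fun μ => ?_
  by_cases h : μ = ν
  · have : {c : Fin 3 → EuclideanSpace ℝ (Fin 3) | μ ≠ ν → ‖c μ‖ < ‖c ν‖} = Set.univ := by
      ext c; simp [h]
    rw [this]; exact MeasurableSet.univ
  · have : {c : Fin 3 → EuclideanSpace ℝ (Fin 3) | μ ≠ ν → ‖c μ‖ < ‖c ν‖} = {c | ‖c μ‖ < ‖c ν‖} := by
      ext c; simp [h]
    rw [this]
    exact measurableSet_lt (continuous_norm.comp (continuous_apply μ)).measurable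
      (continuous_norm.comp (continuous_apply ν)).measurable

/-- Pointwise: `Σ_ν 𝟙_{Amax3 ν} F₃ ≤ F₃` (at most one column is strictly the largest). [folklore] -/
theorem sum_indicator_Amax3_le_F3 (β : ℝ) (c : Fin 3 → EuclideanSpace ℝ (Fin 3)) :
    ∑ ν, (Amax3 ν).indicator (F3 β) c ≤ F3 β c := by
  by_cases h : ∃ ν₀, c ∈ Amax3 ν₀
  · obtain ⟨ν₀, hν₀⟩ := h
    have hother : ∀ ν, ν ≠ ν₀ → c ∉ Amax3 ν := by
      intro ν hν hν'
      exact lt_asymm (hν₀ ν hν) (hν' ν₀ (Ne.symm hν))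
    rw [Finset.sum_eq_single ν₀ (fun ν _ hν => indicator_of_notMem (hother ν hν) _)
      (fun h => (h (Finset.mem_univ _)).elim), indicator_of_mem hν₀]
  · push Not at h
    rw [Finset.sum_eq_zero (fun ν _ => indicator_of_notMem (h ν) _)]
    exact zero_le

/-- Transport of `∫ 𝟙_{Amax3 ν} F₃` to `ν = 2` by the transposition `(ν 2)`. [folklore] -/
theorem lintegral_indicator_Amax3 (β : ℝ) (ν : Fin 3) :
    ∫⁻ c, (Amax3 ν).indicator (F3 β) c = ∫⁻ c, (Amax3 2).indicator (F3 β) c := by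
  have hmp := measurePreserving_comp_perm3 (Equiv.swap ν 2)
  have hmeas : Measurable ((Amax3 2).indicator (F3 β)) := (measurable_F3 β).indicator (measurableSet_Amax3 2)
  have hS : ∀ c : Fin 3 → EuclideanSpace ℝ (Fin 3), c ∘ (Equiv.swap ν 2) ∈ Amax3 2 ↔ c ∈ Amax3 ν := by
    intro c
    simp only [Amax3, Set.mem_setOf_eq, Function.comp_apply, Equiv.swap_apply_right]
    constructor
    · intro h μ hμ
      have hne : Equiv.swap ν 2 μ ≠ 2 := by
        intro h3; apply hμ
        have := congrArg (Equiv.swap ν 2) h3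
        simpa using this
      simpa using h (Equiv.swap ν 2 μ) hne
    · intro h μ hμ
      refine h _ ?_
      intro h'; apply hμ
      have := congrArg (Equiv.swap ν 2) h'
      simpa using this
  rw [← hmp.lintegral_comp hmeas]
  refine lintegral_congr fun c => ?_
  by_cases hc : c ∈ Amax3 ν
  · rw [indicator_of_mem hc, indicator_of_mem ((hS c).2 hc)]
    unfold F3; rw [zmI_perm]
  · rw [indicator_of_notMem hc, indicator_of_notMem (fun h => hc ((hS c).1 h))]

/-- LOWER symmetrisation: `3 · ∫ 𝟙_{Amax3 2} F₃ ≤ ∫ F₃`. [folklore] -/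
theorem three_Amax3_le_lintegral_F3 (β : ℝ) :
    3 * ∫⁻ c, (Amax3 2).indicator (F3 β) c ≤ ∫⁻ c, F3 β c := by
  calc 3 * ∫⁻ c, (Amax3 2).indicator (F3 β) c = ∑ ν : Fin 3, ∫⁻ c, (Amax3 2).indicator (F3 β) c := by simp
    _ = ∑ ν, ∫⁻ c, (Amax3 ν).indicator (F3 β) c :=
        Finset.sum_congr rfl fun ν _ => (lintegral_indicator_Amax3 β ν).symm
    _ = ∫⁻ c, ∑ ν, (Amax3 ν).indicator (F3 β) c :=
        (lintegral_finsetSum _ fun ν _ => (measurable_F3 β).indicator (measurableSet_Amax3 ν)).symm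
    _ ≤ ∫⁻ c, F3 β c := lintegral_mono (sum_indicator_Amax3_le_F3 β)

/-- The two remaining columns lie in the OPEN ball of radius `‖a‖`. -/
def boxLt2 (a : EuclideanSpace ℝ (Fin 3)) : Set (Fin 2 → EuclideanSpace ℝ (Fin 3)) := {x | ∀ μ, ‖x μ‖ < ‖a‖}

/-- `boxLt2 a` is measurable. [folklore] -/
theorem measurableSet_boxLt2 (a : EuclideanSpace ℝ (Fin 3)) : MeasurableSet (boxLt2 a) := by
  have : boxLt2 a = ⋂ μ, {x : Fin 2 → EuclideanSpace ℝ (Fin 3) | ‖x μ‖ < ‖a‖} := by ext x; simp [boxLt2]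
  rw [this]
  exact MeasurableSet.iInter fun μ =>
    measurableSet_lt (continuous_norm.comp (continuous_apply μ)).measurable measurable_const

/-- The strict-box integrand `𝟙_{boxLt2 a}(x)·exp(−βQ₃(x,a) − (‖x‖²+‖a‖²)/2)`. -/
def G3m (β : ℝ) (a : EuclideanSpace ℝ (Fin 3)) (x : Fin 2 → EuclideanSpace ℝ (Fin 3)) : ℝ≥0∞ :=
  (boxLt2 a).indicator (fun x => ENNReal.ofReal (zmI 3 β (Fin.snoc x a))) x

/-- LOWER conditional integral `Φ⁻₃(β,a) = ∫_{‖x_μ‖ < ‖a‖} exp(−βQ₃(x,a) − (‖x‖²+‖a‖²)/2) dx`. -/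
def PhiM3 (β : ℝ) (a : EuclideanSpace ℝ (Fin 3)) : ℝ≥0∞ := ∫⁻ x, G3m β a x

/-- `G3m β a` is measurable. [folklore] -/
theorem measurable_G3m (β : ℝ) (a : EuclideanSpace ℝ (Fin 3)) : Measurable (G3m β a) :=
  (measurable_zmI_three_snoc β a).indicator (measurableSet_boxLt2 a)

/-- `snoc x a` has strictly largest last column iff `x ∈ boxLt2 a`. [folklore] -/
theorem snoc_mem_Amax3_iff (x : Fin 2 → EuclideanSpace ℝ (Fin 3)) (a : EuclideanSpace ℝ (Fin 3)) :
    (Fin.snoc x a : Fin 3 → EuclideanSpace ℝ (Fin 3)) ∈ Amax3 2 ↔ x ∈ boxLt2 a := by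
  have h3 : (Fin.snoc x a : Fin 3 → EuclideanSpace ℝ (Fin 3)) (Fin.last 2) = a := Fin.snoc_last _ _
  simp only [Amax3, boxLt2, Set.mem_setOf_eq]
  rw [Fin.forall_fin_succ', show (2 : Fin 3) = Fin.last 2 from rfl, h3]
  simp only [Fin.snoc_castSucc, ne_eq, not_true_eq_false, IsEmpty.forall_iff, and_true]
  constructor
  · intro h μ; exact h μ (Fin.castSucc_lt_last μ).ne
  · intro h μ _; exact h μ

/-- The strictly-symmetrised integral is `∫ Φ⁻₃(β,a) da`. [folklore] -/
theorem lintegral_Amax3_eq (β : ℝ) : ∫⁻ c, (Amax3 2).indicator (F3 β) c = ∫⁻ a, PhiM3 β a := by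
  rw [lintegral_eq_lintegral_snoc2 _ ((measurable_F3 β).indicator (measurableSet_Amax3 2))]
  refine lintegral_congr fun a => lintegral_congr fun x => ?_
  unfold G3m
  by_cases hx : x ∈ boxLt2 a
  · rw [indicator_of_mem ((snoc_mem_Amax3_iff x a).2 hx), indicator_of_mem hx]; rfl
  · rw [indicator_of_notMem (fun h => hx ((snoc_mem_Amax3_iff x a).1 h)), indicator_of_notMem hx]

/-- ★ LOWER reduction: `3 ∫ Φ⁻₃(β,a) da ≤ ∫ F₃`. [folklore] -/
theorem three_PhiM3_le_lintegral_F3 (β : ℝ) : 3 * ∫⁻ a, PhiM3 β a ≤ ∫⁻ c, F3 β c := by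
  rw [← lintegral_Amax3_eq]; exact three_Amax3_le_lintegral_F3 β

/-- ROTATION INVARIANCE of `Φ⁻₃`. [folklore] -/
theorem PhiM3_map (β : ℝ) (R : EuclideanSpace ℝ (Fin 3) ≃ₗᵢ[ℝ] EuclideanSpace ℝ (Fin 3)) (a : EuclideanSpace ℝ (Fin 3)) :
    PhiM3 β a = PhiM3 β (R a) := by
  unfold PhiM3
  rw [← (measurePreserving_columns2 R).lintegral_comp (measurable_G3m β (R a))]
  refine lintegral_congr fun x => ?_
  have hmem : (fun μ => R (x μ)) ∈ boxLt2 (R a) ↔ x ∈ boxLt2 a := by simp [boxLt2, R.norm_map]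
  unfold G3m
  by_cases hx : x ∈ boxLt2 a
  · rw [indicator_of_mem hx, indicator_of_mem (hmem.2 hx)]
    rw [show (Fin.snoc (fun μ => R (x μ)) (R a) : Fin 3 → EuclideanSpace ℝ (Fin 3)) =
        fun μ => R ((Fin.snoc x a : Fin 3 → EuclideanSpace ℝ (Fin 3)) μ) from (Fin.comp_snoc R x a).symm,
      zmI_map]
  · rw [indicator_of_notMem hx, indicator_of_notMem (fun h => hx (hmem.1 h))]

/-- `Φ⁻₃(β,a) = Φ⁻₃(β, ‖a‖e₃)`. [folklore] -/
theorem PhiM3_eq_axis (β : ℝ) (a : EuclideanSpace ℝ (Fin 3)) : PhiM3 β a = PhiM3 β (‖a‖ • e3) := by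
  obtain ⟨R, hR⟩ := exists_isometry_map_eq_smul_e3 a
  rw [PhiM3_map β R a, hR]

/-! ## §12 The exact rescaled lower kernel `k_β` -/

/-- The rescaled strict box `plSq(y_μ)/(r⁴β) + y_μ2² < 1` for both columns. -/
def boxResc (β r : ℝ) : Set (Fin 2 → EuclideanSpace ℝ (Fin 3)) :=
  {y | ∀ μ, plSq (y μ) / (r ^ 4 * β) + (y μ 2) ^ 2 < 1}

/-- `boxResc` is measurable. [folklore] -/
theorem measurableSet_boxResc (β r : ℝ) : MeasurableSet (boxResc β r) := by
  have : boxResc β r = ⋂ μ, {y : Fin 2 → EuclideanSpace ℝ (Fin 3) | plSq (y μ) / (r ^ 4 * β) + (y μ 2) ^ 2 < 1} := by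
    ext y; simp [boxResc]
  rw [this]
  refine MeasurableSet.iInter fun μ => measurableSet_lt ?_ measurable_const
  have h1 : Continuous fun y : Fin 2 → EuclideanSpace ℝ (Fin 3) => plSq (y μ) := by unfold plSq; fun_prop
  have h2 : Continuous fun y : Fin 2 → EuclideanSpace ℝ (Fin 3) => (y μ 2) ^ 2 := by fun_prop
  exact ((h1.div_const _).add h2).measurable

/-- The real exponential part of the lower kernel. -/
def klowR (β r : ℝ) (y : Fin 2 → EuclideanSpace ℝ (Fin 3)) : ℝ :=
  Real.exp (-((y 0 0 * y 1 1 - y 0 1 * y 1 0) ^ 2 / (r ^ 4 * β) + cr (y 0) (y 1) + (plSq (y 0) + plSq (y 1))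
    + (plSq (y 0) + plSq (y 1)) / (2 * r ^ 2 * β) + r ^ 2 * ((y 0 2) ^ 2 + (y 1 2) ^ 2) / 2))

/-- Auxiliary: `continuous_klowR`. [folklore] -/
theorem continuous_klowR (β r : ℝ) : Continuous (klowR β r) := by unfold klowR cr plSq; fun_prop

/-- THE EXACT RESCALED LOWER KERNEL `k_β(r,y) = 𝟙_{boxResc β r}(y)·klowR β r y`. -/
def klow (β r : ℝ) (y : Fin 2 → EuclideanSpace ℝ (Fin 3)) : ℝ≥0∞ :=
  (boxResc β r).indicator (fun y => ENNReal.ofReal (klowR β r y)) y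

/-- Auxiliary: `measurable_klow`. [folklore] -/
theorem measurable_klow (β r : ℝ) : Measurable (klow β r) :=
  (ENNReal.measurable_ofReal.comp (continuous_klowR β r).measurable).indicator (measurableSet_boxResc β r)

/-- KEY ALGEBRA (lower side): under `x = Λ_r y`, `Λ_r = diag(1/(r√β),1/(r√β),r)` on both columns, the strict-box integrand on the axis IS
`e^{−r²/2}·k_β(r,y)` (`r, β > 0`). [folklore] -/
theorem G3m_Lam2_eq {β r : ℝ} (hβ : 0 < β) (hr : 0 < r) (y : Fin 2 → EuclideanSpace ℝ (Fin 3)) :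
    G3m β (r • e3) (Lam2 (r * Real.sqrt β)⁻¹ r y) = ENNReal.ofReal (Real.exp (-r ^ 2 / 2)) * klow β r y := by
  have hs2 : ((r * Real.sqrt β)⁻¹) ^ 2 = (r ^ 2 * β)⁻¹ := by rw [inv_pow, mul_pow, Real.sq_sqrt hβ.le]
  have hrβ : r ^ 2 * β ≠ 0 := by positivity
  have hr4β : r ^ 4 * β ≠ 0 := by positivity
  have hre3 : ‖r • e3‖ = r := by rw [norm_smul, norm_e3, mul_one, Real.norm_eq_abs, abs_of_pos hr]
  -- the box is the rescaled box
  have hbox : Lam2 (r * Real.sqrt β)⁻¹ r y ∈ boxLt2 (r • e3) ↔ y ∈ boxResc β r := by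
    simp only [boxLt2, boxResc, Set.mem_setOf_eq, hre3, Lam2_apply]
    refine forall_congr' fun μ => ?_
    rw [← abs_of_pos hr, ← abs_norm, ← sq_lt_sq, abs_of_pos hr, normSq_eq_plSq_add, plSq_diag3, diag3_apply_two, hs2]
    rw [show (r ^ 2 * β)⁻¹ * plSq (y μ) + (r * y μ 2) ^ 2 = r ^ 2 * (plSq (y μ) / (r ^ 4 * β) + (y μ 2) ^ 2) by
      field_simp]
    have hr2 : (0 : ℝ) < r ^ 2 := by positivity
    constructor
    · intro h
      by_contra hcon
      push Not at hcon
      have := mul_le_mul_of_nonneg_left hcon hr2.le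
      linarith
    · intro h
      have := mul_lt_mul_of_pos_left h hr2
      linarith
  unfold G3m klow
  by_cases hy : y ∈ boxResc β r
  · rw [indicator_of_mem (hbox.2 hy), indicator_of_mem hy, ← ENNReal.ofReal_mul (Real.exp_pos _).le]
    congr 1
    unfold klowR
    rw [← Real.exp_add, zmI_three_snoc, sum_two_pd_smul_e3, pd_eq_coord, Fin.sum_univ_two, hre3]
    rw [normSq_eq_plSq_add ((Lam2 (r * Real.sqrt β)⁻¹ r y) 0), normSq_eq_plSq_add ((Lam2 (r * Real.sqrt β)⁻¹ r y) 1)]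
    simp only [Lam2_apply, cr_diag3, plSq_diag3, diag3_apply_zero, diag3_apply_one, diag3_apply_two]
    congr 1
    rw [show ((r * Real.sqrt β)⁻¹ * y 0 0 * ((r * Real.sqrt β)⁻¹ * y 1 1) -
        (r * Real.sqrt β)⁻¹ * y 0 1 * ((r * Real.sqrt β)⁻¹ * y 1 0)) ^ 2
        = (((r * Real.sqrt β)⁻¹) ^ 2) ^ 2 * (y 0 0 * y 1 1 - y 0 1 * y 1 0) ^ 2 by ring, hs2]
    field_simp
    ring
  · rw [indicator_of_notMem (fun h => hy (hbox.1 h)), indicator_of_notMem hy, mul_zero]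

/-- ★ LOWER COLUMN IDENTITY: `(rβ)²·Φ⁻₃(β, re₃) = e^{−r²/2}·∫k_β(r,·)` (`r, β > 0`). [folklore] -/
theorem PhiM3_axis_eq {β r : ℝ} (hβ : 0 < β) (hr : 0 < r) :
    ENNReal.ofReal ((r * β) ^ 2) * PhiM3 β (r • e3) = ENNReal.ofReal (Real.exp (-r ^ 2 / 2)) * ∫⁻ y, klow β r y := by
  have hs : (r * Real.sqrt β)⁻¹ ≠ 0 := inv_ne_zero (mul_pos hr (Real.sqrt_pos.2 hβ)).ne'
  have h := lintegral_comp_Lam2 hs hr.ne' _ (measurable_G3m β (r • e3))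
  have hdet : |((r * Real.sqrt β)⁻¹ * (r * Real.sqrt β)⁻¹ * r) ^ 2|⁻¹ = (r * β) ^ 2 := by
    rw [← mul_inv, show r * Real.sqrt β * (r * Real.sqrt β) = r * r * (Real.sqrt β * Real.sqrt β) by ring,
      Real.mul_self_sqrt hβ.le, abs_of_nonneg (sq_nonneg _), ← inv_pow, mul_inv, inv_inv]
    congr 1; field_simp
  unfold PhiM3
  rw [← hdet, ← h, ← lintegral_const_mul _ (measurable_klow β r)]
  exact lintegral_congr fun y => G3m_Lam2_eq hβ hr y

/-- ★★ **LOWER REPRESENTATION**: `3·∫ e^{−‖a‖²/2}‖a‖⁻²·(∫k_β(‖a‖,·)) da ≤ β²·Z₃(β)` (`β > 0`). [folklore] -/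
theorem three_lintegral_klow_le {β : ℝ} (hβ : 0 < β) :
    3 * ∫⁻ a : EuclideanSpace ℝ (Fin 3), ENNReal.ofReal (Real.exp (-‖a‖ ^ 2 / 2) / ‖a‖ ^ 2) * ∫⁻ y, klow β ‖a‖ y
      ≤ ENNReal.ofReal (β ^ 2 * zeroModeZ 3 β) := by
  have hae : ∀ᵐ a : EuclideanSpace ℝ (Fin 3) ∂volume, a ≠ 0 := ae_iff.2 (by simp)
  have hpt : ∀ᵐ a : EuclideanSpace ℝ (Fin 3) ∂volume,
      ENNReal.ofReal (Real.exp (-‖a‖ ^ 2 / 2) / ‖a‖ ^ 2) * ∫⁻ y, klow β ‖a‖ y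
        = ENNReal.ofReal (β ^ 2) * PhiM3 β (‖a‖ • e3) := by
    filter_upwards [hae] with a ha
    have hr : 0 < ‖a‖ := norm_pos_iff.2 ha
    have h := PhiM3_axis_eq hβ hr
    have hr2 : ENNReal.ofReal (‖a‖ ^ 2) ≠ 0 := (ENNReal.ofReal_pos.2 (by positivity)).ne'
    have hr2' : ENNReal.ofReal (‖a‖ ^ 2) ≠ ⊤ := ENNReal.ofReal_ne_top
    calc ENNReal.ofReal (Real.exp (-‖a‖ ^ 2 / 2) / ‖a‖ ^ 2) * ∫⁻ y, klow β ‖a‖ y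
        = (ENNReal.ofReal (‖a‖ ^ 2))⁻¹ * (ENNReal.ofReal (Real.exp (-‖a‖ ^ 2 / 2)) * ∫⁻ y, klow β ‖a‖ y) := by
          rw [ENNReal.ofReal_div_of_pos (by positivity), ENNReal.div_eq_inv_mul, mul_assoc]
      _ = (ENNReal.ofReal (‖a‖ ^ 2))⁻¹ * (ENNReal.ofReal ((‖a‖ * β) ^ 2) * PhiM3 β (‖a‖ • e3)) := by rw [h]
      _ = ENNReal.ofReal (β ^ 2) * PhiM3 β (‖a‖ • e3) := by
          rw [mul_pow, ENNReal.ofReal_mul (sq_nonneg _), ← mul_assoc, ← mul_assoc, ENNReal.inv_mul_cancel hr2 hr2',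
            one_mul]
  rw [lintegral_congr_ae hpt, lintegral_const_mul' _ _ ENNReal.ofReal_ne_top]
  have hax : (∫⁻ a, PhiM3 β a) = ∫⁻ a : EuclideanSpace ℝ (Fin 3), PhiM3 β (‖a‖ • e3) :=
    lintegral_congr fun a => PhiM3_eq_axis β a
  calc 3 * (ENNReal.ofReal (β ^ 2) * ∫⁻ a : EuclideanSpace ℝ (Fin 3), PhiM3 β (‖a‖ • e3))
      = ENNReal.ofReal (β ^ 2) * (3 * ∫⁻ a, PhiM3 β a) := by rw [hax]; ring
    _ ≤ ENNReal.ofReal (β ^ 2) * ∫⁻ c, F3 β c := by gcongr; exact three_PhiM3_le_lintegral_F3 β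
    _ = ENNReal.ofReal (β ^ 2 * zeroModeZ 3 β) := by
        rw [ENNReal.ofReal_mul (sq_nonneg _), ofReal_zeroModeZ 3 hβ.le]; rfl

end Summit.QuantumFields.YangMills.Theorems.ToronValleyVolume.ZeroMode

end
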